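import Summits.Ventures.YMGap.Census.TwistField
import HarnessLib

/-!
# Venture YMGap, track (b) — differentiating a field partition function along an affine line of coefficient fields

HONEST FRAMING: venture file of the cell `pub-ymgap` (QuantumFields programme), track (b); finite tori `(ℤ/Lℤ)^d` only; calculus
plumbing (differentiation under the Haar integral); nothing about (5.15), limits, confinement or a mass gap.

For two coefficient fields `A`, `B : plaquettes → (n ↦ coefficient)` consider the affine line `a_t = A + t B`.  Since every
plaquette weight `Σ_n a_t(p)_n χ_n(U_p)` is affine in `t`, the field partition function `Z(a_t) = ∫ ∏_p (α_p + t β_p) dU`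
(`FieldRP.coefFieldZ`) is a polynomial in `t` whose derivative is the sum over MARKED plaquettes `p₀` of the partition functions
of the fields `a_t` with the coefficient vector of `p₀` replaced by `B_{p₀}` (`hasDerivAt_coefFieldZ_line`; dominated convergence on
the compact configuration space, as in `CoeffMonotone` / `PatternMonotone`).  Consequently a SUM of two such line functions is
non-decreasing on `t ≥ 0` as soon as the paired marked terms are non-negative (`monotoneOn_coefFieldZ_line_add`) — the form in
which Tomboulis's `∂Z⁺/∂c_j ≥ 0` (arXiv:0707.2179 Prop. IV.2 (i)) and the dropping step of App. A §2 are used for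
`Z⁺ = (Z + Z⁻)/2`, whose two halves are the lines of a field and of its twist.

References: E. T. Tomboulis, arXiv:0707.2179, Prop. IV.2 and App. A §2 [cite: Tomboulis2007Confinement, Prop. IV.2, App. A §2].
-/

noncomputable section

open MeasureTheory Finset Real
open scoped BigOperators
open Literature.MathematicalPhysics.QuantumLattice
open Literature.MathematicalPhysics.QuantumFieldTheory
open Literature.MathematicalPhysics.QuantumFieldTheory.Tomboulis2007
open Literature.MathematicalPhysics.QuantumFieldTheory.WilsonRP

namespace Summit.Ventures.YMGap.Census

variable {d L : ℕ}

/-! ### The affine line of fields and its marked fields -/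

/-- The weight of `p` along the line is affine in `t`: `charSum (A_p + t B_p) = charSum A_p + t · charSum B_p`. -/
theorem charSum_line (J : ℕ) (A B : Plaquette d L → ℕ → ℝ) (t : ℝ) (p : Plaquette d L) (r : ℝ) :
    charSum J (fun n => A p n + t * B p n) r = charSum J (A p) r + t * charSum J (B p) r := by
  rw [charSum_add J (A p) (fun n => t * B p n), charSum_smul]

section Line

variable [NeZero L]

/-- **The integrand of `Z(A + tB)` is `∏_p (α_p(W) + t β_p(W))`.** -/
theorem coefFieldFn_line (J : ℕ) (A B : Plaquette d L → ℕ → ℝ) (t : ℝ) (W : GaugeConfig d L SU2) :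
    coefFieldFn J (fun p n => A p n + t * B p n) W =
      ∏ p : Plaquette d L, (charSum J (A p) (plaqRe rhoFund W p) + t * charSum J (B p) (plaqRe rhoFund W p)) := by
  unfold coefFieldFn
  exact Finset.prod_congr rfl fun p _ => charSum_line J A B t p _

/-- **The `p₀`-term of the derivative is the integrand of the marked field** `update (A + tB) p₀ B_{p₀}`. -/
theorem coefFieldFn_line_marked (J : ℕ) (A B : Plaquette d L → ℕ → ℝ) (t : ℝ) (p₀ : Plaquette d L)
    (W : GaugeConfig d L SU2) :
    coefFieldFn J (Function.update (fun p n => A p n + t * B p n) p₀ (B p₀)) W =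
      (∏ p ∈ univ.erase p₀, (charSum J (A p) (plaqRe rhoFund W p) + t * charSum J (B p) (plaqRe rhoFund W p))) *
        charSum J (B p₀) (plaqRe rhoFund W p₀) := by
  unfold coefFieldFn
  rw [← Finset.mul_prod_erase univ _ (Finset.mem_univ p₀), Function.update_self, mul_comm]
  congr 1
  refine Finset.prod_congr rfl fun p hp => ?_
  rw [Function.update_of_ne (Finset.mem_erase.1 hp).1]
  exact charSum_line J A B t p _

/-! ### Continuity and the pointwise derivative -/

omit [NeZero L] in
/-- `W ↦ charSum J b (Re tr U_p)` is continuous. -/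
theorem continuous_charSum_plaqRe (J : ℕ) (b : ℕ → ℝ) (p : Plaquette d L) :
    Continuous fun W : GaugeConfig d L SU2 => charSum J b (plaqRe rhoFund W p) :=
  (continuous_charSum J b).comp (continuous_plaqRe p)

/-- `(t, W) ↦ ∏_p (α_p + t β_p)` is jointly continuous. -/
theorem continuous_line_integrand₂ (J : ℕ) (A B : Plaquette d L → ℕ → ℝ) :
    Continuous fun z : ℝ × GaugeConfig d L SU2 =>
      ∏ p : Plaquette d L, (charSum J (A p) (plaqRe rhoFund z.2 p) + z.1 * charSum J (B p) (plaqRe rhoFund z.2 p)) :=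
  continuous_finsetProd _ fun p _ => ((continuous_charSum_plaqRe J (A p) p).comp continuous_snd).add
    (continuous_fst.mul ((continuous_charSum_plaqRe J (B p) p).comp continuous_snd))

/-- `(t, W) ↦ Σ_{p₀} (∏_{p ≠ p₀} (α_p + t β_p)) β_{p₀}` is jointly continuous. -/
theorem continuous_line_deriv₂ (J : ℕ) (A B : Plaquette d L → ℕ → ℝ) :
    Continuous fun z : ℝ × GaugeConfig d L SU2 => ∑ p₀ : Plaquette d L,
      (∏ p ∈ univ.erase p₀, (charSum J (A p) (plaqRe rhoFund z.2 p) + z.1 * charSum J (B p) (plaqRe rhoFund z.2 p))) *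
        charSum J (B p₀) (plaqRe rhoFund z.2 p₀) := by
  refine continuous_finsetSum _ fun p₀ _ => ?_
  refine (continuous_finsetProd _ fun p _ => ?_).mul ((continuous_charSum_plaqRe J (B p₀) p₀).comp continuous_snd)
  exact ((continuous_charSum_plaqRe J (A p) p).comp continuous_snd).add
    (continuous_fst.mul ((continuous_charSum_plaqRe J (B p) p).comp continuous_snd))

/-- `W ↦ ∏_p (α_p + t β_p)` is continuous. -/
theorem continuous_line_integrand (J : ℕ) (A B : Plaquette d L → ℕ → ℝ) (t : ℝ) :
    Continuous fun W : GaugeConfig d L SU2 =>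
      ∏ p : Plaquette d L, (charSum J (A p) (plaqRe rhoFund W p) + t * charSum J (B p) (plaqRe rhoFund W p)) :=
  continuous_finsetProd _ fun p _ => (continuous_charSum_plaqRe J (A p) p).add
    (continuous_const.mul (continuous_charSum_plaqRe J (B p) p))

/-- `W ↦ Σ_{p₀} (∏_{p ≠ p₀} (α_p + t β_p)) β_{p₀}` is continuous. -/
theorem continuous_line_deriv (J : ℕ) (A B : Plaquette d L → ℕ → ℝ) (t : ℝ) :
    Continuous fun W : GaugeConfig d L SU2 => ∑ p₀ : Plaquette d L,
      (∏ p ∈ univ.erase p₀, (charSum J (A p) (plaqRe rhoFund W p) + t * charSum J (B p) (plaqRe rhoFund W p))) *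
        charSum J (B p₀) (plaqRe rhoFund W p₀) := by
  refine continuous_finsetSum _ fun p₀ _ => ?_
  refine (continuous_finsetProd _ fun p _ => ?_).mul (continuous_charSum_plaqRe J (B p₀) p₀)
  exact (continuous_charSum_plaqRe J (A p) p).add (continuous_const.mul (continuous_charSum_plaqRe J (B p) p))

/-- Pointwise differentiability of the integrand in `t` (product rule). -/
theorem hasDerivAt_line_integrand (J : ℕ) (A B : Plaquette d L → ℕ → ℝ) (W : GaugeConfig d L SU2) (t : ℝ) :
    HasDerivAt (fun s : ℝ =>
        ∏ p : Plaquette d L, (charSum J (A p) (plaqRe rhoFund W p) + s * charSum J (B p) (plaqRe rhoFund W p)))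
      (∑ p₀ : Plaquette d L,
        (∏ p ∈ univ.erase p₀, (charSum J (A p) (plaqRe rhoFund W p) + t * charSum J (B p) (plaqRe rhoFund W p))) *
          charSum J (B p₀) (plaqRe rhoFund W p₀)) t := by
  have h : HasDerivAt (∏ p ∈ (univ : Finset (Plaquette d L)),
      fun s : ℝ => charSum J (A p) (plaqRe rhoFund W p) + s * charSum J (B p) (plaqRe rhoFund W p))
      (∑ p₀ ∈ (univ : Finset (Plaquette d L)),
        (∏ p ∈ univ.erase p₀, (charSum J (A p) (plaqRe rhoFund W p) + t * charSum J (B p) (plaqRe rhoFund W p))) •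
          charSum J (B p₀) (plaqRe rhoFund W p₀)) t :=
    HasDerivAt.finsetProd fun p _ => (hasDerivAt_mul_const _).const_add _
  have hfun : (fun s : ℝ =>
      ∏ p : Plaquette d L, (charSum J (A p) (plaqRe rhoFund W p) + s * charSum J (B p) (plaqRe rhoFund W p))) =
      ∏ p ∈ (univ : Finset (Plaquette d L)),
        fun s : ℝ => charSum J (A p) (plaqRe rhoFund W p) + s * charSum J (B p) (plaqRe rhoFund W p) := by
    funext s
    simp only [Finset.prod_apply]
  rw [hfun]
  simpa only [smul_eq_mul] using h

/-! ### Differentiation under the integral sign -/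

/-- `Z(A + tB) = ∫ ∏_p (α_p + t β_p) dU`. -/
theorem coefFieldZ_line_eq_integral (J : ℕ) (A B : Plaquette d L → ℕ → ℝ) (t : ℝ) :
    coefFieldZ J (fun p n => A p n + t * B p n) =
      ∫ W, ∏ p : Plaquette d L, (charSum J (A p) (plaqRe rhoFund W p) + t * charSum J (B p) (plaqRe rhoFund W p))
        ∂(Measure.pi fun _ : Edge d L => haarProbability SU2) := by
  unfold coefFieldZ
  exact integral_congr_ae (ae_of_all _ fun W => coefFieldFn_line J A B t W)

/-- `Σ_{p₀} Z(update (A + tB) p₀ B_{p₀}) = ∫ Σ_{p₀} (∏_{p ≠ p₀} (α_p + t β_p)) β_{p₀} dU`. -/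
theorem sum_coefFieldZ_marked_eq_integral (J : ℕ) (A B : Plaquette d L → ℕ → ℝ) (t : ℝ) :
    (∑ p₀ : Plaquette d L, coefFieldZ J (Function.update (fun p n => A p n + t * B p n) p₀ (B p₀))) =
      ∫ W, ∑ p₀ : Plaquette d L,
        (∏ p ∈ univ.erase p₀, (charSum J (A p) (plaqRe rhoFund W p) + t * charSum J (B p) (plaqRe rhoFund W p))) *
          charSum J (B p₀) (plaqRe rhoFund W p₀) ∂(Measure.pi fun _ : Edge d L => haarProbability SU2) := by
  haveI : SecondCountableTopology SU2 := secondCountableTopology_su2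
  rw [integral_finsetSum _ (fun p₀ _ => ?_)]
  · unfold coefFieldZ
    exact Finset.sum_congr rfl fun p₀ _ => integral_congr_ae (ae_of_all _ fun W => coefFieldFn_line_marked J A B t p₀ W)
  · have hc : Continuous fun W : GaugeConfig d L SU2 =>
        (∏ p ∈ univ.erase p₀, (charSum J (A p) (plaqRe rhoFund W p) + t * charSum J (B p) (plaqRe rhoFund W p))) *
          charSum J (B p₀) (plaqRe rhoFund W p₀) :=
      (continuous_finsetProd _ fun p _ => (continuous_charSum_plaqRe J (A p) p).add
        (continuous_const.mul (continuous_charSum_plaqRe J (B p) p))).mul (continuous_charSum_plaqRe J (B p₀) p₀)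
    exact integrable_of_continuous_fin hc

variable [NeZero d] [Fact (1 < L)]

omit [NeZero d] [Fact (1 < L)] in
/-- **`d/dt Z(A + tB) = Σ_{p₀} Z(update (A + tB) p₀ B_{p₀})`** (the integrand and its `t`-derivative are continuous, hence bounded
on the compact `[t-1, t+1] × SU(2)^{links}`; `hasDerivAt_integral_of_dominated_loc_of_deriv_le`). -/
theorem hasDerivAt_coefFieldZ_line (J : ℕ) (A B : Plaquette d L → ℕ → ℝ) (t₀ : ℝ) :
    HasDerivAt (fun t => coefFieldZ J (fun p n => A p n + t * B p n))
      (∑ p₀ : Plaquette d L, coefFieldZ J (Function.update (fun p n => A p n + t₀ * B p n) p₀ (B p₀))) t₀ := by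
  haveI : SecondCountableTopology SU2 := secondCountableTopology_su2
  have hZ : (fun t => coefFieldZ J (fun p n => A p n + t * B p n)) = fun t =>
      ∫ W, ∏ p : Plaquette d L, (charSum J (A p) (plaqRe rhoFund W p) + t * charSum J (B p) (plaqRe rhoFund W p))
        ∂(Measure.pi fun _ : Edge d L => haarProbability SU2) :=
    funext fun t => coefFieldZ_line_eq_integral J A B t
  rw [hZ, sum_coefFieldZ_marked_eq_integral]
  have hK : IsCompact (Metric.closedBall t₀ 1 ×ˢ (Set.univ : Set (GaugeConfig d L SU2))) :=
    (isCompact_closedBall t₀ 1).prod isCompact_univ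
  obtain ⟨K, hKb⟩ := hK.exists_bound_of_continuousOn (continuous_line_deriv₂ J A B).continuousOn
  have hbound : ∀ᵐ W ∂(Measure.pi fun _ : Edge d L => haarProbability SU2), ∀ t ∈ Metric.ball t₀ 1,
      ‖∑ p₀ : Plaquette d L,
        (∏ p ∈ univ.erase p₀, (charSum J (A p) (plaqRe rhoFund W p) + t * charSum J (B p) (plaqRe rhoFund W p))) *
          charSum J (B p₀) (plaqRe rhoFund W p₀)‖ ≤ K :=
    ae_of_all _ fun W t ht => hKb (t, W) ⟨Metric.ball_subset_closedBall ht, Set.mem_univ _⟩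
  have key := hasDerivAt_integral_of_dominated_loc_of_deriv_le
    (μ := Measure.pi fun _ : Edge d L => haarProbability SU2)
    (F := fun t W => ∏ p : Plaquette d L,
      (charSum J (A p) (plaqRe rhoFund W p) + t * charSum J (B p) (plaqRe rhoFund W p)))
    (F' := fun t W => ∑ p₀ : Plaquette d L,
      (∏ p ∈ univ.erase p₀, (charSum J (A p) (plaqRe rhoFund W p) + t * charSum J (B p) (plaqRe rhoFund W p))) *
        charSum J (B p₀) (plaqRe rhoFund W p₀))
    (x₀ := t₀) (bound := fun _ => K) (Metric.ball_mem_nhds t₀ one_pos)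
    (Filter.Eventually.of_forall fun t => (continuous_line_integrand J A B t).aestronglyMeasurable)
    (integrable_of_continuous_fin (continuous_line_integrand J A B t₀))
    ((continuous_line_deriv J A B t₀).aestronglyMeasurable)
    hbound (integrable_const K) (ae_of_all _ fun W t _ => hasDerivAt_line_integrand J A B W t)
  exact key.2

omit [NeZero d] [Fact (1 < L)] in
/-- **Monotonicity criterion for a sum of two lines.**  If for every `t > 0` and every marked plaquette `p₀` the SUM of the two
marked partition functions is `≥ 0`, then `t ↦ Z(A + tB) + Z(A' + tB')` is non-decreasing on `[0, ∞)`. -/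
theorem monotoneOn_coefFieldZ_line_add (J : ℕ) (A B A' B' : Plaquette d L → ℕ → ℝ)
    (h : ∀ t : ℝ, 0 < t → ∀ p₀ : Plaquette d L,
      0 ≤ coefFieldZ J (Function.update (fun p n => A p n + t * B p n) p₀ (B p₀)) +
        coefFieldZ J (Function.update (fun p n => A' p n + t * B' p n) p₀ (B' p₀))) :
    MonotoneOn (fun t => coefFieldZ J (fun p n => A p n + t * B p n) + coefFieldZ J (fun p n => A' p n + t * B' p n))
      (Set.Ici 0) := by
  have hderiv : ∀ s, HasDerivAt
      (fun t => coefFieldZ J (fun p n => A p n + t * B p n) + coefFieldZ J (fun p n => A' p n + t * B' p n))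
      ((∑ p₀ : Plaquette d L, coefFieldZ J (Function.update (fun p n => A p n + s * B p n) p₀ (B p₀))) +
        ∑ p₀ : Plaquette d L, coefFieldZ J (Function.update (fun p n => A' p n + s * B' p n) p₀ (B' p₀))) s :=
    fun s => (hasDerivAt_coefFieldZ_line J A B s).add (hasDerivAt_coefFieldZ_line J A' B' s)
  refine monotoneOn_of_deriv_nonneg (convex_Ici 0) ?_ ?_ ?_
  · exact HasDerivAt.continuousOn fun s _ => hderiv s
  · exact fun s _ => (hderiv s).differentiableAt.differentiableWithinAt
  · intro s hs
    rw [interior_Ici] at hs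
    rw [(hderiv s).deriv, ← Finset.sum_add_distrib]
    exact Finset.sum_nonneg fun p₀ _ => h s hs p₀

omit [NeZero d] [Fact (1 < L)] in
/-- The criterion applied between `t = 0` and `t = 1`: `Z(A) + Z(A') ≤ Z(A + B) + Z(A' + B')`. -/
theorem coefFieldZ_add_le_of_marked_nonneg (J : ℕ) (A B A' B' : Plaquette d L → ℕ → ℝ)
    (h : ∀ t : ℝ, 0 < t → ∀ p₀ : Plaquette d L,
      0 ≤ coefFieldZ J (Function.update (fun p n => A p n + t * B p n) p₀ (B p₀)) +
        coefFieldZ J (Function.update (fun p n => A' p n + t * B' p n) p₀ (B' p₀))) :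
    coefFieldZ J A + coefFieldZ J A' ≤
      coefFieldZ J (fun p n => A p n + B p n) + coefFieldZ J (fun p n => A' p n + B' p n) := by
  have hm := monotoneOn_coefFieldZ_line_add J A B A' B' h (Set.mem_Ici.2 le_rfl) (Set.mem_Ici.2 zero_le_one) zero_le_one
  have h0 : (fun p n => A p n + (0 : ℝ) * B p n) = A := by funext p n; ring
  have h0' : (fun p n => A' p n + (0 : ℝ) * B' p n) = A' := by funext p n; ring
  have h1 : (fun p n => A p n + (1 : ℝ) * B p n) = fun p n => A p n + B p n := by funext p n; ring
  have h1' : (fun p n => A' p n + (1 : ℝ) * B' p n) = fun p n => A' p n + B' p n := by funext p n; ring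
  simp only [h0, h0', h1, h1'] at hm
  exact hm

end Line

end Summit.Ventures.YMGap.Census

end
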